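import Summits.BirchSwinnertonDyer.BirchSwinnertonDyer.Theorems.InertBadSignedBranchesCccOneLawOnTypeIstarZeroStubHalves
import HarnessLib

/-!
# Route `InertBadSignedBranches` (rung K8), crux `CccOneLawOnTypeIstarZero`: the three REGISTERED
# STUBS of the skeleton (`Cruxes/CccOneLawOnTypeIstarZero/Lines/birth.lean`, A12 shape; registered on
# stmt-BirchSwinnertonDyer-19223 by `ledger skeleton check`) READ ON THE TYPE, modulo the route's own
# support items — NV discharged, U ⟺ the upper half (published at `p ≥ 11`), L ⟺ `LowerHalfOnType`
# (helper toward stmt-BirchSwinnertonDyer-19223; cell bsd-cm, seat bsd-cm-k8i-c2; nothing asserted)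

The registered stubs (their signatures spelled out verbatim below, each at one prime `p ≥ 5`):
NV `stub_etaBranchNonvanishing` (`coeff₁ L ≠ 0`), U `stub_etaValuationUpper`
(`v_p(coeff₁ L) ≤ 2n + ord_p(q·Tam/#tors²)`), L `stub_etaValuationLower` (the reverse inequality);
`CccOneLawOnTypeIstarZero_of` = ⟨NV, le_antisymm U L⟩. Modulo the route's OWN support items
`PrintReadingsInert` (stmt-…-19226: (C1_η) on the CM good-inert twins, (R2), the exact Kobayashi
7.4 (ii) reading) and `PublishedFactsInert` (stmt-…-19227: `hmod hGZ hGZK hPT hnf` + Mazur's period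
datum), with (C3_η) discharged from the readings (x1b `LevelBridge.…_of_readings`) and the datum of
the law SUPPLIED on the type (x1b `pairData_elim`):

* §1 `stubNonvanishingAt_of_printReadings` — **NV HOLDS at every `p ≥ 5`** (inert g11's
  `coeff_one_ne_zero_of_exactReading` lifted to the type; uses only `hGZK`, `hPT`, (C1_η), the exact
  reading).
* §2 `stubUpperAt_iff_upperHalfOnType` — **U at `p` ⟺ ∀ `W` of the type with `r_an = 1`,
  `MissingUpperBoundAt W p`**; `stubUpperAt_of_facts_of_seven_lt` — **U HOLDS at every `p ≥ 11`**
  from the eleven published facts of x1b's every-curve Kolyvagin half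
  (`X12.missingUpperBoundAt_of_classX12_of_cmInert`).
* §3 `stubLowerAt_iff_lowerHalfOnType` — **L at `p` ⟺ `X12.O10.LowerHalfOnType p I₀*`** (the
  main-conjecture half `ord_p #Ш_an ≤ ord_p #Ш` on the type, STEP L — in no source);
  `cccOneLawAt_iff_stubLowerAt_of_seven_lt` — at `p ≥ 11` the `p`-slice of the crux ⟺ L alone.
* §4 `cccOneLawOnTypeIstarZero_of_stubLower_of_upperHalf_five_seven` — the skeleton's composition
  re-read: the crux ⟸ L at every `p ≥ 5` + the upper half on the type at `p ∈ {5, 7}` (where the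
  every-curve Kolyvagin half carries its Manin datum), modulo the same items and facts.
READING: the registered skeleton's open content, modulo the route's support items and print, is
EXACTLY the stub L = the lower half on the type; NV and U are print-plus-bookkeeping at `p ≥ 11`.

HONEST LABEL: every statement is CONDITIONAL on displayed hypotheses (the route's typed support
items, published named facts); no `def`, no named fact minted, nothing booked; no registered stub
is closed outright (they are unconditional); the crux 19223 and O10 stay OPEN at class level.
[cite: Kobayashi2003, §4 (p. 8), Thm. 7.4 (p. 13), Thm. 9.3 (p. 26)] [cite: Miller2011LMS, §1 and Def. 1.1]
[cite: MatarNekovar2019, Thm. 0.3 and §0.11] [cite: EdixhovenManin1991, Thm. 3] [cite: Mazur1978, Cor. 4.1]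
-/

set_option autoImplicit false
set_option linter.dupNamespace false

noncomputable section

open scoped Classical MatrixGroups ModularForm NumberField

open CongruenceSubgroup Field WeierstrassCurve NumberField IsDedekindDomain
open Literature.NumberTheory.EllipticCurves
open Literature.NumberTheory.EllipticCurves.ModularForms
open Literature.NumberTheory.EllipticCurves.Kobayashi2003 hiding IsQuadraticBranchMinusLFunction
open Literature.NumberTheory.EllipticCurves.Rank1Residual
open Literature.NumberTheory.EllipticCurves.Rank1Residual.Typed
open Literature.NumberTheory.GaloisRepresentations Literature.NumberTheory.GaloisCohomology
open Summit.BirchSwinnertonDyer.Rank1Residual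
open Summit.BirchSwinnertonDyer.Rank1Residual.Additive
open Summit.BirchSwinnertonDyer.Rank1Residual.X12.O10
open Summit.BirchSwinnertonDyer.BirchSwinnertonDyer.Theses.InertBadSignedBranches

namespace Summit.BirchSwinnertonDyer.BirchSwinnertonDyer.Theorems.CccOneStubHalves

variable (p : ℕ) [hp : Fact p.Prime]

/-! ## §1 Stub NV on the type, from the route's readings -/

/-- **Stub `stub_etaBranchNonvanishing` HOLDS at every `p ≥ 5`, modulo `PrintReadingsInert` + GZK +
Poitou–Tate**: for `W` of signed type `(p, I₀*)` with `r_an = 1` and every datum of the law,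
`coeff₁ L_p⁻(V, η, X) ≠ 0` — inert g11's `coeff_one_ne_zero_of_exactReading` (the characteristic
element of the strict minus dual Selmer module has non-zero constant term in Mordell–Weil rank one;
the exact Kobayashi 7.4 (ii) reading identifies it with `L/X`), the twins being CM good-inert
(`hasCM_and_cmInert_of_twist`) so that (C1_η) of 19226 feeds the reading. CONDITIONAL; nothing booked.
[cite: Kobayashi2003, §4 (p. 8) and Thm. 7.4 (p. 13)] [cite: GreenbergLNM1716, §4 Lemma 4.2 (p. 102)] -/
theorem stubNonvanishingAt_of_printReadings (h₅ : PrintReadingsInert)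
    (hGZK : rank_eq_analyticRank_of_analyticRank_le_one)
    (hPT : poitouTate_selmerStructure_duality_real ℚ) (hp5 : 5 ≤ p) :
    ∀ (W : WeierstrassCurve ℚ) [W.IsElliptic] [W.IsGloballyMinimal],
      HasSignedLocalType W p (.Istar 0) → W.analyticRank = 1 →
      ∀ (V : WeierstrassCurve ℚ) [V.IsElliptic] [V.IsGloballyMinimal] (C : VariableChange ℚ)
        {N : ℕ} [NeZero N] {f : CuspForm (Gamma0 N) 2},
        5 ≤ p → C • W.quadraticTwist ((-1) ^ (p / 2) * p) = V →
        V.HasGoodReductionAtPrime p → V.frobeniusTrace p = 0 → W.analyticRank = 1 →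
        IsNewformOf V f →
        ∀ (ϖ : ℚ), (if Even (p / 2) then (ϖ : ℝ) * V.realPeriodRat = plusPeriod f
            else (ϖ : ℝ) * V.imaginaryPeriodRat = minusPeriod f) →
        ∀ (L : IwasawaAlgebra p), IsQuadraticBranchMinusLFunction f p ϖ L →
        (∀ Q : (W.baseChange ℚ_[p]).toAffine.Point, p • Q = 0 → Q = 0) →
        ∀ (P : W.toAffine.Point) (n : ℕ), ¬ IsOfFinAddOrder P →
        (∀ R : W.toAffine.Point, ∃ (k : ℤ) (T : W.toAffine.Point),
          IsOfFinAddOrder T ∧ R = k • P + T) →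
        (∃ Q : (W.baseChange ℚ_[p]).toAffine.Point, p ^ n • Q = W.toPadicPoint p P) →
        (∀ Q : (W.baseChange ℚ_[p]).toAffine.Point, p ^ (n + 1) • Q ≠ W.toPadicPoint p P) →
        ∀ (q : ℚ), shaAn W = (q : ℂ) →
        PowerSeries.coeff 1 L ≠ 0 := by
  intro W _ _ hT hr V _ _ C _ _ _ _ hC hgood hap _ hf ϖ hϖ L hL _ P n hP hgen hdiv hndiv _ _
  obtain ⟨hC1, hRd⟩ := h₅ p hp5
  obtain ⟨-, h74x⟩ := hRd W hT hr
  haveI : Finite W.sha := (hGZK W hr.le).2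
  have hp2 : p ≠ 2 := by omega
  obtain ⟨hCM, hin⟩ := CccOneLowerHalf.hasCM_and_cmInert_of_twist W p hT C hC
  exact CccOneLowerHalf.coeff_one_ne_zero_of_exactReading W p hPT hp2 C hC hgood hap hL hP hgen hdiv
    hndiv fun κ γ hκ hγ hγc D L' hLL' ↦
      h74x V C hp2 hC hgood hap (hC1 V hCM hgood hin) hf ϖ hϖ L hL κ γ hκ hγ hγc D L' hLL'

/-! ## §2 Stub U on the type ⟺ the UPPER half of `BSD_p` on the type -/

/-- **Stub `stub_etaValuationUpper` at `p` ⟺ the upper half on the type**, modulo `PrintReadingsInert`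
and `PublishedFactsInert`: (∀ `W` of signed type `(p, I₀*)` with `r_an = 1`, at every datum
`v_p(coeff₁ L) ≤ 2n + ord_p(q·Tam/#tors²)`) ↔ (∀ such `W`, `MissingUpperBoundAt W p`, i.e.
`ord_p #Ш(W) ≤ ord_p #Ш(W)_an`). (→): a datum exists on the type (x1b `pairData_elim` with Mazur's
period datum), `#Ш_an ∈ ℚ`, (C3_η) from the readings, NV from §1, then the per-datum bookkeeping;
(←): the per-datum bookkeeping. CONDITIONAL; nothing booked.
[cite: Kobayashi2003, Thm. 9.3 (p. 26)] [cite: Miller2011LMS, §1 and Def. 1.1] [cite: Mazur1978, Cor. 4.1] -/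
theorem stubUpperAt_iff_upperHalfOnType (h₅ : PrintReadingsInert) (h₆ : PublishedFactsInert)
    (hp5 : 5 ≤ p) :
    (∀ (W : WeierstrassCurve ℚ) [W.IsElliptic] [W.IsGloballyMinimal],
      HasSignedLocalType W p (.Istar 0) → W.analyticRank = 1 →
      ∀ (V : WeierstrassCurve ℚ) [V.IsElliptic] [V.IsGloballyMinimal] (C : VariableChange ℚ)
        {N : ℕ} [NeZero N] {f : CuspForm (Gamma0 N) 2},
        5 ≤ p → C • W.quadraticTwist ((-1) ^ (p / 2) * p) = V →
        V.HasGoodReductionAtPrime p → V.frobeniusTrace p = 0 → W.analyticRank = 1 →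
        IsNewformOf V f →
        ∀ (ϖ : ℚ), (if Even (p / 2) then (ϖ : ℝ) * V.realPeriodRat = plusPeriod f
            else (ϖ : ℝ) * V.imaginaryPeriodRat = minusPeriod f) →
        ∀ (L : IwasawaAlgebra p), IsQuadraticBranchMinusLFunction f p ϖ L →
        (∀ Q : (W.baseChange ℚ_[p]).toAffine.Point, p • Q = 0 → Q = 0) →
        ∀ (P : W.toAffine.Point) (n : ℕ), ¬ IsOfFinAddOrder P →
        (∀ R : W.toAffine.Point, ∃ (k : ℤ) (T : W.toAffine.Point),
          IsOfFinAddOrder T ∧ R = k • P + T) →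
        (∃ Q : (W.baseChange ℚ_[p]).toAffine.Point, p ^ n • Q = W.toPadicPoint p P) →
        (∀ Q : (W.baseChange ℚ_[p]).toAffine.Point, p ^ (n + 1) • Q ≠ W.toPadicPoint p P) →
        ∀ (q : ℚ), shaAn W = (q : ℂ) →
        ((PowerSeries.coeff 1 L : ℤ_[p]) : ℚ_[p]).valuation ≤
          2 * (n : ℤ) + padicValRat p (q * W.tamagawaProduct / (W.torsionOrder : ℚ) ^ 2)) ↔
    ∀ (W : WeierstrassCurve ℚ) [W.IsElliptic] [W.IsGloballyMinimal],
      HasSignedLocalType W p (.Istar 0) → W.analyticRank = 1 → MissingUpperBoundAt W p := by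
  obtain ⟨hmod, hGZ, hGZK, hPT, hnf, hM⟩ := h₆
  obtain ⟨hC1, hRd⟩ := h₅ p hp5
  have hp2 : p ≠ 2 := by omega
  constructor
  · intro hU W _ _ hT hr
    obtain ⟨hR2, h74x⟩ := hRd W hT hr
    haveI : Finite W.sha := (hGZK W hr.le).2
    obtain ⟨q, hq⟩ := Disegni2020.exists_rat_shaAn_eq_of_analyticRank_eq_one hGZ hGZK W hr
    have h3 := LevelBridge.quadraticBranchOddStrictExactControlOfPlusMCAt_of_readings W p hPT hGZK hR2 h74x
    refine pairData_elim hGZK hnf (periodRatio_of_mazur p hM hp5) W hT hr hp5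
      fun V _ _ C _ _ f ϖ L P n hC hgood hap hCM hin hf hϖ hL htors hP hgen hdiv hndiv ↦ ?_
    have h1V : QuadraticBranchPlusMainConjectureAt V p := hC1 V hCM hgood hin
    have hne : PowerSeries.coeff 1 L ≠ 0 :=
      CccOneLowerHalf.coeff_one_ne_zero_of_exactReading W p hPT hp2 C hC hgood hap hL hP hgen hdiv
        hndiv fun κ γ hκ hγ hγc D L' hLL' ↦
          h74x V C hp2 hC hgood hap h1V hf ϖ hϖ L hL κ γ hκ hγ hγc D L' hLL'
    exact missingUpperBoundAt_of_valuation_coeff_one_le_of_exactControl W p hmod h3 hp5 hC hgood hap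
      h1V hf hϖ hL htors hP hgen hdiv hndiv hr hne hq
      (hU W hT hr V C hp5 hC hgood hap hr hf ϖ hϖ L hL htors P n hP hgen hdiv hndiv q hq)
  · intro hup W _ _ hT hr V _ _ C _ _ _ _ hC hgood hap _ hf ϖ hϖ L hL htors P n hP hgen hdiv hndiv q hq
    obtain ⟨hR2, h74x⟩ := hRd W hT hr
    haveI : Finite W.sha := (hGZK W hr.le).2
    have h3 := LevelBridge.quadraticBranchOddStrictExactControlOfPlusMCAt_of_readings W p hPT hGZK hR2 h74x
    obtain ⟨hCM, hin⟩ := CccOneLowerHalf.hasCM_and_cmInert_of_twist W p hT C hC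
    have h1V : QuadraticBranchPlusMainConjectureAt V p := hC1 V hCM hgood hin
    have hne : PowerSeries.coeff 1 L ≠ 0 :=
      CccOneLowerHalf.coeff_one_ne_zero_of_exactReading W p hPT hp2 C hC hgood hap hL hP hgen hdiv
        hndiv fun κ γ hκ hγ hγc D L' hLL' ↦
          h74x V C hp2 hC hgood hap h1V hf ϖ hϖ L hL κ γ hκ hγ hγc D L' hLL'
    exact valuation_coeff_one_le_of_missingUpperBoundAt_of_exactControl W p hmod (hup W hT hr) h3 hp5
      hC hgood hap h1V hf hϖ hL htors hP hgen hdiv hndiv hr hne q hq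

/-- **Stub `stub_etaValuationUpper` HOLDS at every `p ≥ 11`**, modulo `PrintReadingsInert`,
`PublishedFactsInert` and the eleven published facts of x1b's every-curve Kolyvagin half on the inert
core (`X12.missingUpperBoundAt_of_classX12_of_cmInert`: Gross–Zagier and Kolyvagin over a
Friedberg–Hoffstein field in Matar–Nekovář's form, the CM rank-zero triple for the twist, Edixhoven
and Deuring for the Manin constant, Cassels): §2's (←). CONDITIONAL; nothing booked.
[cite: MatarNekovar2019, Thm. 0.3 and §0.11] [cite: EdixhovenManin1991, Thm. 3]
[cite: BurungaleFlach2024, Thm. 1.1 and Cor. 2] [cite: MilneADT2006, Thm. I.7.3 and Remark I.7.4] -/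
theorem stubUpperAt_of_facts_of_seven_lt (h₅ : PrintReadingsInert) (h₆ : PublishedFactsInert)
    (hGZ : ∀ (N : ℕ) [NeZero N] (W : WeierstrassCurve ℚ) (K : Type) [Field K] [NumberField K],
      gross_zagier N W K)
    (hKo : ∀ (N : ℕ) [NeZero N] (W : WeierstrassCurve ℚ) (K : Type) [Field K] [NumberField K],
      kolyvagin N W K)
    (hMN : ∀ (N : ℕ) [NeZero N] (W : WeierstrassCurve ℚ) (K : Type) [Field K] [NumberField K],
      MatarNekovar2019.thm03_padicValNat_card_sha_le_of_irreducible N W K)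
    (hFH : friedbergHoffstein_exists_heegnerField_split_twist_ne_zero)
    (hCM8 : bsdTriple_of_hasCM_of_L_one_ne_zero)
    (hEdx : edixhoven_not_dvd_maninConstant_of_not_potentiallyGoodOrdinary)
    (hDeu : deuring_not_hasUnitRootAt_of_hasCM_of_not_cmSplit) (hCassels : bsdRHS_eq_of_isIsogenous)
    (hp7 : 7 < p) :
    ∀ (W : WeierstrassCurve ℚ) [W.IsElliptic] [W.IsGloballyMinimal],
      HasSignedLocalType W p (.Istar 0) → W.analyticRank = 1 →
      ∀ (V : WeierstrassCurve ℚ) [V.IsElliptic] [V.IsGloballyMinimal] (C : VariableChange ℚ)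
        {N : ℕ} [NeZero N] {f : CuspForm (Gamma0 N) 2},
        5 ≤ p → C • W.quadraticTwist ((-1) ^ (p / 2) * p) = V →
        V.HasGoodReductionAtPrime p → V.frobeniusTrace p = 0 → W.analyticRank = 1 →
        IsNewformOf V f →
        ∀ (ϖ : ℚ), (if Even (p / 2) then (ϖ : ℝ) * V.realPeriodRat = plusPeriod f
            else (ϖ : ℝ) * V.imaginaryPeriodRat = minusPeriod f) →
        ∀ (L : IwasawaAlgebra p), IsQuadraticBranchMinusLFunction f p ϖ L →
        (∀ Q : (W.baseChange ℚ_[p]).toAffine.Point, p • Q = 0 → Q = 0) →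
        ∀ (P : W.toAffine.Point) (n : ℕ), ¬ IsOfFinAddOrder P →
        (∀ R : W.toAffine.Point, ∃ (k : ℤ) (T : W.toAffine.Point),
          IsOfFinAddOrder T ∧ R = k • P + T) →
        (∃ Q : (W.baseChange ℚ_[p]).toAffine.Point, p ^ n • Q = W.toPadicPoint p P) →
        (∀ Q : (W.baseChange ℚ_[p]).toAffine.Point, p ^ (n + 1) • Q ≠ W.toPadicPoint p P) →
        ∀ (q : ℚ), shaAn W = (q : ℂ) →
        ((PowerSeries.coeff 1 L : ℤ_[p]) : ℚ_[p]).valuation ≤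
          2 * (n : ℤ) + padicValRat p (q * W.tamagawaProduct / (W.torsionOrder : ℚ) ^ 2) := by
  have hp5 : 5 ≤ p := by omega
  have h₆' := h₆
  obtain ⟨hmod, -, hGZK, -, hnf, -⟩ := h₆'
  exact (stubUpperAt_iff_upperHalfOnType p h₅ h₆ hp5).mpr fun W _ _ hT hr ↦
    X12.missingUpperBoundAt_of_classX12_of_cmInert hGZ hKo hMN hGZK hmod hnf hFH hCM8 hEdx hDeu hCassels
      W p (classX12_of_hasSignedLocalType W p hT hr) hp7 hT.2.1.1 hT.2.1.2

/-! ## §3 Stub L on the type ⟺ the LOWER half of `BSD_p` on the type (`LowerHalfOnType`) -/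

/-- **Stub `stub_etaValuationLower` at `p` ⟺ `X12.O10.LowerHalfOnType p I₀*`** (the main-conjecture
half `ord_p #Ш(W)_an ≤ ord_p #Ш(W)` for every rank-one `W` of the type), modulo `PrintReadingsInert`
and `PublishedFactsInert` — same bookkeeping as §2 with the inequalities reversed. So the hardest
registered stub IS the class target of record (STEP L on the type; the `η`-branch leading-term
formula is in no source). CONDITIONAL; nothing booked; O10 stays OPEN.
[cite: Kobayashi2003, Thm. 9.3 (p. 26)] [cite: Miller2011LMS, §1 and Def. 1.1] [cite: Mazur1978, Cor. 4.1] -/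
theorem stubLowerAt_iff_lowerHalfOnType (h₅ : PrintReadingsInert) (h₆ : PublishedFactsInert)
    (hp5 : 5 ≤ p) :
    (∀ (W : WeierstrassCurve ℚ) [W.IsElliptic] [W.IsGloballyMinimal],
      HasSignedLocalType W p (.Istar 0) → W.analyticRank = 1 →
      ∀ (V : WeierstrassCurve ℚ) [V.IsElliptic] [V.IsGloballyMinimal] (C : VariableChange ℚ)
        {N : ℕ} [NeZero N] {f : CuspForm (Gamma0 N) 2},
        5 ≤ p → C • W.quadraticTwist ((-1) ^ (p / 2) * p) = V →
        V.HasGoodReductionAtPrime p → V.frobeniusTrace p = 0 → W.analyticRank = 1 →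
        IsNewformOf V f →
        ∀ (ϖ : ℚ), (if Even (p / 2) then (ϖ : ℝ) * V.realPeriodRat = plusPeriod f
            else (ϖ : ℝ) * V.imaginaryPeriodRat = minusPeriod f) →
        ∀ (L : IwasawaAlgebra p), IsQuadraticBranchMinusLFunction f p ϖ L →
        (∀ Q : (W.baseChange ℚ_[p]).toAffine.Point, p • Q = 0 → Q = 0) →
        ∀ (P : W.toAffine.Point) (n : ℕ), ¬ IsOfFinAddOrder P →
        (∀ R : W.toAffine.Point, ∃ (k : ℤ) (T : W.toAffine.Point),
          IsOfFinAddOrder T ∧ R = k • P + T) →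
        (∃ Q : (W.baseChange ℚ_[p]).toAffine.Point, p ^ n • Q = W.toPadicPoint p P) →
        (∀ Q : (W.baseChange ℚ_[p]).toAffine.Point, p ^ (n + 1) • Q ≠ W.toPadicPoint p P) →
        ∀ (q : ℚ), shaAn W = (q : ℂ) →
        2 * (n : ℤ) + padicValRat p (q * W.tamagawaProduct / (W.torsionOrder : ℚ) ^ 2) ≤
          ((PowerSeries.coeff 1 L : ℤ_[p]) : ℚ_[p]).valuation) ↔
    LowerHalfOnType p (.Istar 0) := by
  obtain ⟨hmod, hGZ, hGZK, hPT, hnf, hM⟩ := h₆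
  obtain ⟨hC1, hRd⟩ := h₅ p hp5
  have hp2 : p ≠ 2 := by omega
  constructor
  · intro hLo W _ _ hT hr
    obtain ⟨hR2, h74x⟩ := hRd W hT hr
    haveI : Finite W.sha := (hGZK W hr.le).2
    obtain ⟨q, hq⟩ := Disegni2020.exists_rat_shaAn_eq_of_analyticRank_eq_one hGZ hGZK W hr
    have h3 := LevelBridge.quadraticBranchOddStrictExactControlOfPlusMCAt_of_readings W p hPT hGZK hR2 h74x
    refine pairData_elim hGZK hnf (periodRatio_of_mazur p hM hp5) W hT hr hp5
      fun V _ _ C _ _ f ϖ L P n hC hgood hap hCM hin hf hϖ hL htors hP hgen hdiv hndiv ↦ ?_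
    have h1V : QuadraticBranchPlusMainConjectureAt V p := hC1 V hCM hgood hin
    have hne : PowerSeries.coeff 1 L ≠ 0 :=
      CccOneLowerHalf.coeff_one_ne_zero_of_exactReading W p hPT hp2 C hC hgood hap hL hP hgen hdiv
        hndiv fun κ γ hκ hγ hγc D L' hLL' ↦
          h74x V C hp2 hC hgood hap h1V hf ϖ hϖ L hL κ γ hκ hγ hγc D L' hLL'
    exact missingLowerBoundAt_of_le_valuation_coeff_one_of_exactControl W p hmod h3 hp5 hC hgood hap
      h1V hf hϖ hL htors hP hgen hdiv hndiv hr hne hq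
      (hLo W hT hr V C hp5 hC hgood hap hr hf ϖ hϖ L hL htors P n hP hgen hdiv hndiv q hq)
  · intro hlow W _ _ hT hr V _ _ C _ _ _ _ hC hgood hap _ hf ϖ hϖ L hL htors P n hP hgen hdiv hndiv q hq
    obtain ⟨hR2, h74x⟩ := hRd W hT hr
    haveI : Finite W.sha := (hGZK W hr.le).2
    have h3 := LevelBridge.quadraticBranchOddStrictExactControlOfPlusMCAt_of_readings W p hPT hGZK hR2 h74x
    obtain ⟨hCM, hin⟩ := CccOneLowerHalf.hasCM_and_cmInert_of_twist W p hT C hC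
    have h1V : QuadraticBranchPlusMainConjectureAt V p := hC1 V hCM hgood hin
    have hne : PowerSeries.coeff 1 L ≠ 0 :=
      CccOneLowerHalf.coeff_one_ne_zero_of_exactReading W p hPT hp2 C hC hgood hap hL hP hgen hdiv
        hndiv fun κ γ hκ hγ hγc D L' hLL' ↦
          h74x V C hp2 hC hgood hap h1V hf ϖ hϖ L hL κ γ hκ hγ hγc D L' hLL'
    exact le_valuation_coeff_one_of_missingLowerBoundAt_of_exactControl W p hmod (hlow W hT hr) h3
      hp5 hC hgood hap h1V hf hϖ hL htors hP hgen hdiv hndiv hr hne q hq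

/-- **At each `p ≥ 11`: the `p`-slice of the crux ⟺ stub `stub_etaValuationLower` at `p` ALONE**,
modulo `PrintReadingsInert`, `PublishedFactsInert` and the eleven published facts of the every-curve
upper half (inert g11's `cccOneLawAt_iff_lowerHalfOnType_of_seven_lt` ∘ §3). CONDITIONAL; nothing booked.
[cite: MatarNekovar2019, Thm. 0.3 and §0.11] [cite: EdixhovenManin1991, Thm. 3] [cite: Miller2011LMS, §1 and Def. 1.1] -/
theorem cccOneLawAt_iff_stubLowerAt_of_seven_lt (h₅ : PrintReadingsInert) (h₆ : PublishedFactsInert)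
    (hGZ : ∀ (N : ℕ) [NeZero N] (W : WeierstrassCurve ℚ) (K : Type) [Field K] [NumberField K],
      gross_zagier N W K)
    (hKo : ∀ (N : ℕ) [NeZero N] (W : WeierstrassCurve ℚ) (K : Type) [Field K] [NumberField K],
      kolyvagin N W K)
    (hMN : ∀ (N : ℕ) [NeZero N] (W : WeierstrassCurve ℚ) (K : Type) [Field K] [NumberField K],
      MatarNekovar2019.thm03_padicValNat_card_sha_le_of_irreducible N W K)
    (hFH : friedbergHoffstein_exists_heegnerField_split_twist_ne_zero)
    (hCM8 : bsdTriple_of_hasCM_of_L_one_ne_zero)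
    (hEdx : edixhoven_not_dvd_maninConstant_of_not_potentiallyGoodOrdinary)
    (hDeu : deuring_not_hasUnitRootAt_of_hasCM_of_not_cmSplit) (hCassels : bsdRHS_eq_of_isIsogenous)
    (hp7 : 7 < p) :
    (∀ (W : WeierstrassCurve ℚ) [W.IsElliptic] [W.IsGloballyMinimal],
        HasSignedLocalType W p (.Istar 0) → W.analyticRank = 1 →
        QuadraticBranchPAdicGrossZagierValuationAt W p) ↔
    ∀ (W : WeierstrassCurve ℚ) [W.IsElliptic] [W.IsGloballyMinimal],
      HasSignedLocalType W p (.Istar 0) → W.analyticRank = 1 →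
      ∀ (V : WeierstrassCurve ℚ) [V.IsElliptic] [V.IsGloballyMinimal] (C : VariableChange ℚ)
        {N : ℕ} [NeZero N] {f : CuspForm (Gamma0 N) 2},
        5 ≤ p → C • W.quadraticTwist ((-1) ^ (p / 2) * p) = V →
        V.HasGoodReductionAtPrime p → V.frobeniusTrace p = 0 → W.analyticRank = 1 →
        IsNewformOf V f →
        ∀ (ϖ : ℚ), (if Even (p / 2) then (ϖ : ℝ) * V.realPeriodRat = plusPeriod f
            else (ϖ : ℝ) * V.imaginaryPeriodRat = minusPeriod f) →
        ∀ (L : IwasawaAlgebra p), IsQuadraticBranchMinusLFunction f p ϖ L →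
        (∀ Q : (W.baseChange ℚ_[p]).toAffine.Point, p • Q = 0 → Q = 0) →
        ∀ (P : W.toAffine.Point) (n : ℕ), ¬ IsOfFinAddOrder P →
        (∀ R : W.toAffine.Point, ∃ (k : ℤ) (T : W.toAffine.Point),
          IsOfFinAddOrder T ∧ R = k • P + T) →
        (∃ Q : (W.baseChange ℚ_[p]).toAffine.Point, p ^ n • Q = W.toPadicPoint p P) →
        (∀ Q : (W.baseChange ℚ_[p]).toAffine.Point, p ^ (n + 1) • Q ≠ W.toPadicPoint p P) →
        ∀ (q : ℚ), shaAn W = (q : ℂ) →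
        2 * (n : ℤ) + padicValRat p (q * W.tamagawaProduct / (W.torsionOrder : ℚ) ^ 2) ≤
          ((PowerSeries.coeff 1 L : ℤ_[p]) : ℚ_[p]).valuation := by
  have hp5 : 5 ≤ p := by omega
  exact (CccOneLowerHalf.cccOneLawAt_iff_lowerHalfOnType_of_seven_lt p h₅ h₆ hGZ hKo hMN hFH hCM8 hEdx
    hDeu hCassels hp7).trans (stubLowerAt_iff_lowerHalfOnType p h₅ h₆ hp5).symm

/-! ## §4 The skeleton's composition re-read: L everywhere + the upper half at `p ∈ {5, 7}` -/

/-- **The crux FOLLOWS from stub `stub_etaValuationLower` at every `p ≥ 5` together with the UPPER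
half on the type at `p ∈ {5, 7}`** (where the every-curve Kolyvagin half carries its Manin datum;
at `p ≥ 11` it is published), modulo `PrintReadingsInert`, `PublishedFactsInert` and the eleven
published facts: §3 gives the lower half, x1b's `bsdp_of_classX12_of_cmInert_of_lower` / the two
halves give `BSD_p` on the type, inert g11's `cccOneLawOnTypeIstarZero_of_bsdpOnType` gives the crux.
So NV and U of the skeleton are DISPENSABLE at `p ≥ 11`. CONDITIONAL; nothing booked.
[cite: MatarNekovar2019, Thm. 0.3 and §0.11] [cite: EdixhovenManin1991, Thm. 3] [cite: Miller2011LMS, §1 and Def. 1.1] -/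
theorem cccOneLawOnTypeIstarZero_of_stubLower_of_upperHalf_five_seven (h₅ : PrintReadingsInert)
    (h₆ : PublishedFactsInert)
    (hGZ : ∀ (N : ℕ) [NeZero N] (W : WeierstrassCurve ℚ) (K : Type) [Field K] [NumberField K],
      gross_zagier N W K)
    (hKo : ∀ (N : ℕ) [NeZero N] (W : WeierstrassCurve ℚ) (K : Type) [Field K] [NumberField K],
      kolyvagin N W K)
    (hMN : ∀ (N : ℕ) [NeZero N] (W : WeierstrassCurve ℚ) (K : Type) [Field K] [NumberField K],
      MatarNekovar2019.thm03_padicValNat_card_sha_le_of_irreducible N W K)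
    (hFH : friedbergHoffstein_exists_heegnerField_split_twist_ne_zero)
    (hCM8 : bsdTriple_of_hasCM_of_L_one_ne_zero)
    (hEdx : edixhoven_not_dvd_maninConstant_of_not_potentiallyGoodOrdinary)
    (hDeu : deuring_not_hasUnitRootAt_of_hasCM_of_not_cmSplit) (hCassels : bsdRHS_eq_of_isIsogenous)
    (hlow : ∀ (p : ℕ) [Fact p.Prime], 5 ≤ p →
      ∀ (W : WeierstrassCurve ℚ) [W.IsElliptic] [W.IsGloballyMinimal],
      HasSignedLocalType W p (.Istar 0) → W.analyticRank = 1 →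
      ∀ (V : WeierstrassCurve ℚ) [V.IsElliptic] [V.IsGloballyMinimal] (C : VariableChange ℚ)
        {N : ℕ} [NeZero N] {f : CuspForm (Gamma0 N) 2},
        5 ≤ p → C • W.quadraticTwist ((-1) ^ (p / 2) * p) = V →
        V.HasGoodReductionAtPrime p → V.frobeniusTrace p = 0 → W.analyticRank = 1 →
        IsNewformOf V f →
        ∀ (ϖ : ℚ), (if Even (p / 2) then (ϖ : ℝ) * V.realPeriodRat = plusPeriod f
            else (ϖ : ℝ) * V.imaginaryPeriodRat = minusPeriod f) →
        ∀ (L : IwasawaAlgebra p), IsQuadraticBranchMinusLFunction f p ϖ L →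
        (∀ Q : (W.baseChange ℚ_[p]).toAffine.Point, p • Q = 0 → Q = 0) →
        ∀ (P : W.toAffine.Point) (n : ℕ), ¬ IsOfFinAddOrder P →
        (∀ R : W.toAffine.Point, ∃ (k : ℤ) (T : W.toAffine.Point),
          IsOfFinAddOrder T ∧ R = k • P + T) →
        (∃ Q : (W.baseChange ℚ_[p]).toAffine.Point, p ^ n • Q = W.toPadicPoint p P) →
        (∀ Q : (W.baseChange ℚ_[p]).toAffine.Point, p ^ (n + 1) • Q ≠ W.toPadicPoint p P) →
        ∀ (q : ℚ), shaAn W = (q : ℂ) →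
        2 * (n : ℤ) + padicValRat p (q * W.tamagawaProduct / (W.torsionOrder : ℚ) ^ 2) ≤
          ((PowerSeries.coeff 1 L : ℤ_[p]) : ℚ_[p]).valuation)
    (hup57 : ∀ (p : ℕ) [Fact p.Prime], p = 5 ∨ p = 7 →
      ∀ (W : WeierstrassCurve ℚ) [W.IsElliptic] [W.IsGloballyMinimal],
      HasSignedLocalType W p (.Istar 0) → W.analyticRank = 1 → MissingUpperBoundAt W p) :
    CccOneLawOnTypeIstarZero := by
  have h₆' := h₆
  obtain ⟨hmod, -, hGZK, hPT, hnf, -⟩ := h₆'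
  refine CccOneLowerHalf.cccOneLawOnTypeIstarZero_of_bsdpOnType h₅ hmod hGZK hPT
    fun p _ hp5 W _ _ hT hr ↦ ?_
  have hlo : MissingLowerBoundAt W p :=
    (stubLowerAt_iff_lowerHalfOnType p h₅ h₆ hp5).mp (hlow p hp5) W hT hr
  by_cases hp7 : 7 < p
  · exact X12.bsdp_of_classX12_of_cmInert_of_lower hGZ hKo hMN hGZK hmod hnf hFH hCM8 hEdx hDeu
      hCassels W p (classX12_of_hasSignedLocalType W p hT hr) hp7 hT.2.1.1 hT.2.1.2 hlo
  · have hpP : p.Prime := Fact.out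
    have h57 : p = 5 ∨ p = 7 := by
      have hle : p ≤ 7 := Nat.le_of_not_lt hp7
      have h6 : p ≠ 6 := by
        rintro rfl
        exact absurd hpP (by norm_num)
      omega
    exact bsdp_of_missingPPartAt W p hGZK hr.le
      (missingPPartAt_of_lower_of_upper W p hlo (hup57 p h57 W hT hr))

end Summit.BirchSwinnertonDyer.BirchSwinnertonDyer.Theorems.CccOneStubHalves

end
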